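import Literature.Probability.Percolation.DecisionTreeMixed
import Summits.CriticalPhenomena.PercolationContinuityZ3.Theorems.PercNearOneGluingNoHeavyQuantTreeCount
import HarnessLib

/-!
# The decision-tree criterion for `TN ≤ m·E` with per-node `S`/`S̄` decisions, and the cover form

builds on p205010 (kernel theorem, internal audit signed; external expert review pending)

Support file (`--supports stmt-CriticalPhenomena-4575`), seat `prim-quant-p1` (gen 45); memo
`run/shared/lean/prim/quant/prim-quant-p1-g45/FOR-LEAD-Z32-COVER.md`.  No definitions, no named facts, no sorries;
standard axioms.

✓ p627517 (`…QuantTreeCount`) turned "one adaptive edge-revealing algorithm whose hybrid `X →_{revealed} (D∖X)` lands in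
`E` on a `1/m` fraction of TN" into `#TN ≤ m·#E`, for trees sending EVERY queried edge to `S` (then the hybrid map is an
involution).  Gladkov's Definition 2.4 [Gladkov2024] is more general — every node also DECIDES whether its edge goes to `S`
(hybrid keeps `X` there) or to `S̄` (hybrid is complemented there although the edge was read: a "peek") — and his
Lemma 3.1 still makes the hybrid map a bijection of `𝒫(D)` (`Literature…DecisionTreeMixed`: `MTree`, `MTree.kept`,
`MTree.injOn_hybrid`; NOT an involution any more).  Numerically (memo §2) the extra freedom strictly enlarges the
achievable win sets (e.g. on `K_{2,3}` one tree with peeks wins ALL of TN, none without), so the criterion is recorded in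
this generality:
* `TreeCount.card_mwins_le`, `card_mwins'_le` — wins are distinct (both sides) for every valid `MTree`;
* `TreeCount.card_le_mul_of_mtree`, `…_of_mtree'`, `TreeCount.card_le_mul_of_mtrees` — the criterion for one tree /
  a finite family with sides counted with multiplicity ("randomized tree");
* `TreeCount.card_le_card_mul_of_mcover` — **the cover form**: if every `X ∈ TN` is won by at least one member of a
  finite family `K` of (tree, side) pairs, then `#TN ≤ #K · #W` (memo §1: on every graph with `≤ 5` vertices TWO trees
  cover TN, i.e. this gives `TN ≤ 2E` there; the three-port target is `3`);
* `ThreeClusterSwap.productRow_of_mtreeWins`, `ThreeClusterSwap.productRow_of_mtreeCover` — plugged into ✓ p583525: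
  one good tree with decisions per class winning a third of TN, resp. THREE (tree, side) pairs per class covering TN,
  give `P(abc)·P(a|b|c) ≤ 3·(P(ab|c)+P(ac|b))` on every finite weighted graph (the hypothesis of ✓ p560550).
-/

namespace Summit.CriticalPhenomena.PercolationContinuityZ3.Theorems

open Finset Literature.Probability.Percolation Literature.Probability.Percolation.DecisionTree
open scoped Classical

namespace TreeCount

variable {ι : Type*} [DecidableEq ι]

/-- **Wins are distinct (side `S`)** for a tree with decisions: for any predicates `TN`, `W` and any `MTree` valid on
some `seen`, the number of `X ⊆ D` in `TN` whose hybrid `X →_{S(X)} (D∖X)` satisfies `W` is at most `#W`.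
[this work] -/
theorem card_mwins_le (D : Finset ι) (T : MTree ι) {seen : Finset ι} (hT : T.ValidOn seen)
    (TN W : Finset ι → Prop) :
    (D.powerset.filter fun X => TN X ∧ W (splice (T.kept X) X (D \ X))).card ≤
      (D.powerset.filter fun Z => W Z).card := by
  refine Finset.card_le_card_of_injOn (fun X => splice (T.kept X) X (D \ X)) (fun X hX => ?_)
    fun X hX X' hX' h => ?_
  · rw [mem_coe, mem_filter, mem_powerset] at hX ⊢
    exact ⟨MTree.hybrid_subset T hX.1, hX.2.2⟩
  · rw [mem_coe, mem_filter] at hX hX'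
    exact MTree.injOn_hybrid D T seen hT (mem_coe.2 hX.1) (mem_coe.2 hX'.1) h

/-- **Wins are distinct (side `S̄`)**: the same for the complementary hybrid `(D∖X) →_{S(X)} X`. [this work] -/
theorem card_mwins'_le (D : Finset ι) (T : MTree ι) {seen : Finset ι} (hT : T.ValidOn seen)
    (TN W : Finset ι → Prop) :
    (D.powerset.filter fun X => TN X ∧ W (splice (T.kept X) (D \ X) X)).card ≤
      (D.powerset.filter fun Z => W Z).card := by
  refine Finset.card_le_card_of_injOn (fun X => splice (T.kept X) (D \ X) X) (fun X hX => ?_)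
    fun X hX X' hX' h => ?_
  · rw [mem_coe, mem_filter, mem_powerset] at hX ⊢
    exact ⟨splice_subset sdiff_subset hX.1, hX.2.2⟩
  · rw [mem_coe, mem_filter] at hX hX'
    exact MTree.injOn_hybrid' D T seen hT (mem_coe.2 hX.1) (mem_coe.2 hX'.1) h

/-- The win count of a (tree, side) pair: side `false` = hybrid `X →_{S(X)} (D∖X)`, side `true` = the complementary
hybrid; either way at most `#W`. [this work] -/
theorem card_mwins_side_le (D : Finset ι) (T : MTree ι) {seen : Finset ι} (hT : T.ValidOn seen) (side : Bool)
    (TN W : Finset ι → Prop) :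
    (D.powerset.filter fun X => TN X ∧
      W (if side then splice (T.kept X) (D \ X) X else splice (T.kept X) X (D \ X))).card ≤
      (D.powerset.filter fun Z => W Z).card := by
  cases side
  · simp only [Bool.false_eq_true, ↓reduceIte]
    exact card_mwins_le D T hT TN W
  · simp only [↓reduceIte]
    exact card_mwins'_le D T hT TN W

/-- **The criterion (side `S`) for trees with decisions.**  If one valid `MTree` wins on at least a `1/m` fraction of
`TN` (`#TN ≤ m·#wins`), then `#TN ≤ m·#W`. [this work] -/
theorem card_le_mul_of_mtree (D : Finset ι) (T : MTree ι) {seen : Finset ι} (hT : T.ValidOn seen)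
    (TN W : Finset ι → Prop) (m : ℕ)
    (h : (D.powerset.filter fun X => TN X).card ≤
      m * (D.powerset.filter fun X => TN X ∧ W (splice (T.kept X) X (D \ X))).card) :
    (D.powerset.filter fun X => TN X).card ≤ m * (D.powerset.filter fun Z => W Z).card :=
  h.trans (Nat.mul_le_mul_left m (card_mwins_le D T hT TN W))

/-- **The criterion (side `S̄`) for trees with decisions.** [this work] -/
theorem card_le_mul_of_mtree' (D : Finset ι) (T : MTree ι) {seen : Finset ι} (hT : T.ValidOn seen)
    (TN W : Finset ι → Prop) (m : ℕ)
    (h : (D.powerset.filter fun X => TN X).card ≤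
      m * (D.powerset.filter fun X => TN X ∧ W (splice (T.kept X) (D \ X) X)).card) :
    (D.powerset.filter fun X => TN X).card ≤ m * (D.powerset.filter fun Z => W Z).card :=
  h.trans (Nat.mul_le_mul_left m (card_mwins'_le D T hT TN W))

/-- **The criterion for a finite family of (tree with decisions, side) pairs** ("randomized tree" with rational
weights): if `(#family)·#TN ≤ m · Σ_k #wins_k` then `#TN ≤ m·#W`. [this work] -/
theorem card_le_mul_of_mtrees (D : Finset ι) {κ : Type*} (K : Finset κ) (hK : K.Nonempty)
    (T : κ → MTree ι) (seen : κ → Finset ι) (hT : ∀ k ∈ K, (T k).ValidOn (seen k)) (side : κ → Bool)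
    (TN W : Finset ι → Prop) (m : ℕ)
    (h : K.card * (D.powerset.filter fun X => TN X).card ≤
      m * ∑ k ∈ K, (D.powerset.filter fun X => TN X ∧
        W (if side k then splice ((T k).kept X) (D \ X) X else splice ((T k).kept X) X (D \ X))).card) :
    (D.powerset.filter fun X => TN X).card ≤ m * (D.powerset.filter fun Z => W Z).card := by
  have hsum : ∑ k ∈ K, (D.powerset.filter fun X => TN X ∧
      W (if side k then splice ((T k).kept X) (D \ X) X else splice ((T k).kept X) X (D \ X))).card ≤
        K.card * (D.powerset.filter fun Z => W Z).card := by
    calc _ ≤ ∑ k ∈ K, (D.powerset.filter fun Z => W Z).card :=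
          Finset.sum_le_sum fun k hk => card_mwins_side_le D (T k) (hT k hk) (side k) TN W
      _ = K.card * (D.powerset.filter fun Z => W Z).card := by rw [Finset.sum_const, smul_eq_mul]
  have h2 : K.card * (D.powerset.filter fun X => TN X).card ≤
      K.card * (m * (D.powerset.filter fun Z => W Z).card) := by
    calc _ ≤ m * (K.card * (D.powerset.filter fun Z => W Z).card) := h.trans (Nat.mul_le_mul_left m hsum)
      _ = K.card * (m * (D.powerset.filter fun Z => W Z).card) := by ring
  exact Nat.le_of_mul_le_mul_left h2 (Finset.card_pos.2 hK)

/-- **The cover form of the criterion.**  If every configuration `X ⊆ D` in `TN` is WON by at least one member of a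
finite family `K` of (tree with decisions, side) pairs — its hybrid for that member satisfies `W` — then
`#TN ≤ #K · #W`: `TN` is contained in the union of the `#K` win sets, each of cardinality at most `#W` by injectivity.
(Two covering trees give `TN ≤ 2·W`, three give `TN ≤ 3·W`.) [this work] -/
theorem card_le_card_mul_of_mcover (D : Finset ι) {κ : Type*} (K : Finset κ)
    (T : κ → MTree ι) (seen : κ → Finset ι) (hT : ∀ k ∈ K, (T k).ValidOn (seen k)) (side : κ → Bool)
    (TN W : Finset ι → Prop)
    (hcover : ∀ X ∈ D.powerset, TN X → ∃ k ∈ K,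
      W (if side k then splice ((T k).kept X) (D \ X) X else splice ((T k).kept X) X (D \ X))) :
    (D.powerset.filter fun X => TN X).card ≤ K.card * (D.powerset.filter fun Z => W Z).card := by
  classical
  -- TN ⊆ ⋃_k wins_k
  have hsub : (D.powerset.filter fun X => TN X) ⊆ K.biUnion fun k => D.powerset.filter fun X => TN X ∧
      W (if side k then splice ((T k).kept X) (D \ X) X else splice ((T k).kept X) X (D \ X)) := by
    intro X hX
    rw [mem_filter] at hX
    obtain ⟨k, hk, hw⟩ := hcover X hX.1 hX.2
    exact Finset.mem_biUnion.2 ⟨k, hk, mem_filter.2 ⟨hX.1, hX.2, hw⟩⟩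
  calc (D.powerset.filter fun X => TN X).card
      ≤ (K.biUnion fun k => D.powerset.filter fun X => TN X ∧
          W (if side k then splice ((T k).kept X) (D \ X) X else splice ((T k).kept X) X (D \ X))).card :=
        Finset.card_le_card hsub
    _ ≤ ∑ k ∈ K, (D.powerset.filter fun X => TN X ∧
          W (if side k then splice ((T k).kept X) (D \ X) X else splice ((T k).kept X) X (D \ X))).card :=
        Finset.card_biUnion_le
    _ ≤ ∑ k ∈ K, (D.powerset.filter fun Z => W Z).card :=
        Finset.sum_le_sum fun k hk => card_mwins_side_le D (T k) (hT k hk) (side k) TN W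
    _ = K.card * (D.powerset.filter fun Z => W Z).card := by rw [Finset.sum_const, smul_eq_mul]

/-- The all-`S` criterion of ✓ p627517 is the special case `keep ≡ true`: the win count of a `DTree` equals the win count
of the corresponding `MTree.ofDTree`. [this work] -/
theorem card_wins_ofDTree (D : Finset ι) (T : DTree ι) (TN W : Finset ι → Prop) :
    (D.powerset.filter fun X => TN X ∧ W (splice ((MTree.ofDTree T).kept X) X (D \ X))).card =
      (D.powerset.filter fun X => TN X ∧ W (splice (revealed T X) X (D \ X))).card := by
  simp only [MTree.kept_ofDTree]

end TreeCount

/-! ### Plugging the criterion into the product row -/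

namespace ThreeClusterSwap

variable {V : Type*} [Fintype V] [DecidableEq V]

/-- **Product row from one good tree WITH DECISIONS per class.**  If in every class `I ⊆ U` (free edges `F = U ∖ I`)
there is a decision tree with per-node `S`/`S̄` decisions (`MTree`, valid) and a side such that three times the number of
TN-configurations `T` of the class whose hybrid (`T →_{S(T)} (F∖T)` for side `false`, `(F∖T) →_{S(T)} T` for side `true`),
read as a first configuration, lies in `ab|c ∪ ac|b`, is at least the number of TN-configurations of the class, then
`P(abc)·P(a|b|c) ≤ 3·(P(ab|c) + P(ac|b))` on every finite weighted graph (the hypothesis shape of ✓ p560550).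
By ✓ p583525 `productRow_of_classCount` and `TreeCount.card_le_mul_of_mtree[']`. [this work] -/
theorem productRow_of_mtreeWins (w : Sym2 V → unitInterval) (a b c : V)
    (h : ∀ I U : Finset (Sym2 V), I ⊆ U → ∃ (T : MTree (Sym2 V)) (side : Bool),
      T.ValidOn ∅ ∧
      (((U \ I).powerset).filter fun T =>
          (¬ (openGraph (↑(I ∪ ((U \ I) \ T)) : Set (Sym2 V))).Reachable a b ∧
            ¬ (openGraph (↑(I ∪ ((U \ I) \ T)) : Set (Sym2 V))).Reachable a c ∧
            ¬ (openGraph (↑(I ∪ ((U \ I) \ T)) : Set (Sym2 V))).Reachable b c) ∧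
          ((openGraph (↑(I ∪ T) : Set (Sym2 V))).Reachable a b ∧
            (openGraph (↑(I ∪ T) : Set (Sym2 V))).Reachable a c)).card ≤
        3 * (((U \ I).powerset).filter fun X =>
          ((¬ (openGraph (↑(I ∪ ((U \ I) \ X)) : Set (Sym2 V))).Reachable a b ∧
            ¬ (openGraph (↑(I ∪ ((U \ I) \ X)) : Set (Sym2 V))).Reachable a c ∧
            ¬ (openGraph (↑(I ∪ ((U \ I) \ X)) : Set (Sym2 V))).Reachable b c) ∧
          ((openGraph (↑(I ∪ X) : Set (Sym2 V))).Reachable a b ∧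
            (openGraph (↑(I ∪ X) : Set (Sym2 V))).Reachable a c)) ∧
          (let Z := if side then splice (T.kept X) ((U \ I) \ X) X else splice (T.kept X) X ((U \ I) \ X)
           ((openGraph (↑(I ∪ Z) : Set (Sym2 V))).Reachable a b ∧
              ¬ (openGraph (↑(I ∪ Z) : Set (Sym2 V))).Reachable a c) ∨
            ((openGraph (↑(I ∪ Z) : Set (Sym2 V))).Reachable a c ∧
              ¬ (openGraph (↑(I ∪ Z) : Set (Sym2 V))).Reachable a b))).card) :
    (Literature.Probability.LatticeModels.prodBernoulli w).real (openConn a b ∩ openConn a c) *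
      (Literature.Probability.LatticeModels.prodBernoulli w).real
        ((openConn a b)ᶜ ∩ (openConn a c)ᶜ ∩ (openConn b c)ᶜ) ≤
    3 * ((Literature.Probability.LatticeModels.prodBernoulli w).real (openConn a b ∩ (openConn a c)ᶜ) +
      (Literature.Probability.LatticeModels.prodBernoulli w).real (openConn a c ∩ (openConn a b)ᶜ)) := by
  refine productRow_of_classCount w a b c (m := 3) (by norm_num) fun I U hIU => ?_
  obtain ⟨T, side, hT, hcount⟩ := h I U hIU
  set D : Finset (Sym2 V) := U \ I with hD
  let R : Finset (Sym2 V) → V → V → Prop := fun S x y => (openGraph (↑S : Set (Sym2 V))).Reachable x y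
  let TN : Finset (Sym2 V) → Prop := fun X =>
    (¬ R (I ∪ (D \ X)) a b ∧ ¬ R (I ∪ (D \ X)) a c ∧ ¬ R (I ∪ (D \ X)) b c) ∧ (R (I ∪ X) a b ∧ R (I ∪ X) a c)
  let W : Finset (Sym2 V) → Prop := fun Z => (R (I ∪ Z) a b ∧ ¬ R (I ∪ Z) a c) ∨ (R (I ∪ Z) a c ∧ ¬ R (I ∪ Z) a b)
  have key : (D.powerset.filter fun X => TN X).card ≤ 3 * (D.powerset.filter fun Z => W Z).card := by
    cases side
    · simp only [Bool.false_eq_true, ↓reduceIte] at hcount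
      have k0 := TreeCount.card_le_mul_of_mtree D T hT TN W 3 (by convert hcount using 5)
      convert k0 using 5
    · simp only [↓reduceIte] at hcount
      have k1 := TreeCount.card_le_mul_of_mtree' D T hT TN W 3 (by convert hcount using 5)
      convert k1 using 5
  have e : ((D.powerset.filter fun X => TN X).card : ℝ) ≤ 3 * ((D.powerset.filter fun Z => W Z).card : ℝ) := by
    exact_mod_cast key
  exact e

/-- **Product row from a THREE-TREE COVER per class** (the transfer-lemma shape of Gladkov's Lemma 7.1): if in every
class `I ⊆ U` there are three (tree with decisions, side) pairs such that EVERY TN-configuration of the class is won by at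
least one of them (its hybrid, read as a first configuration, lies in `ab|c ∪ ac|b`), then
`P(abc)·P(a|b|c) ≤ 3·(P(ab|c) + P(ac|b))` on every finite weighted graph.  By `TreeCount.card_le_card_mul_of_mcover`
and ✓ p583525. [this work] -/
theorem productRow_of_mtreeCover (w : Sym2 V → unitInterval) (a b c : V)
    (h : ∀ I U : Finset (Sym2 V), I ⊆ U → ∃ (T : Fin 3 → MTree (Sym2 V)) (side : Fin 3 → Bool),
      (∀ k, (T k).ValidOn ∅) ∧
      ∀ X ∈ (U \ I).powerset,
        ((¬ (openGraph (↑(I ∪ ((U \ I) \ X)) : Set (Sym2 V))).Reachable a b ∧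
            ¬ (openGraph (↑(I ∪ ((U \ I) \ X)) : Set (Sym2 V))).Reachable a c ∧
            ¬ (openGraph (↑(I ∪ ((U \ I) \ X)) : Set (Sym2 V))).Reachable b c) ∧
          ((openGraph (↑(I ∪ X) : Set (Sym2 V))).Reachable a b ∧
            (openGraph (↑(I ∪ X) : Set (Sym2 V))).Reachable a c)) →
        ∃ k : Fin 3,
          (let Z := if side k then splice ((T k).kept X) ((U \ I) \ X) X else splice ((T k).kept X) X ((U \ I) \ X)
           ((openGraph (↑(I ∪ Z) : Set (Sym2 V))).Reachable a b ∧
              ¬ (openGraph (↑(I ∪ Z) : Set (Sym2 V))).Reachable a c) ∨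
            ((openGraph (↑(I ∪ Z) : Set (Sym2 V))).Reachable a c ∧
              ¬ (openGraph (↑(I ∪ Z) : Set (Sym2 V))).Reachable a b))) :
    (Literature.Probability.LatticeModels.prodBernoulli w).real (openConn a b ∩ openConn a c) *
      (Literature.Probability.LatticeModels.prodBernoulli w).real
        ((openConn a b)ᶜ ∩ (openConn a c)ᶜ ∩ (openConn b c)ᶜ) ≤
    3 * ((Literature.Probability.LatticeModels.prodBernoulli w).real (openConn a b ∩ (openConn a c)ᶜ) +
      (Literature.Probability.LatticeModels.prodBernoulli w).real (openConn a c ∩ (openConn a b)ᶜ)) := by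
  refine productRow_of_classCount w a b c (m := 3) (by norm_num) fun I U hIU => ?_
  obtain ⟨T, side, hT, hcover⟩ := h I U hIU
  set D : Finset (Sym2 V) := U \ I with hD
  let R : Finset (Sym2 V) → V → V → Prop := fun S x y => (openGraph (↑S : Set (Sym2 V))).Reachable x y
  let TN : Finset (Sym2 V) → Prop := fun X =>
    (¬ R (I ∪ (D \ X)) a b ∧ ¬ R (I ∪ (D \ X)) a c ∧ ¬ R (I ∪ (D \ X)) b c) ∧ (R (I ∪ X) a b ∧ R (I ∪ X) a c)
  let W : Finset (Sym2 V) → Prop := fun Z => (R (I ∪ Z) a b ∧ ¬ R (I ∪ Z) a c) ∨ (R (I ∪ Z) a c ∧ ¬ R (I ∪ Z) a b)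
  have key₀ := TreeCount.card_le_card_mul_of_mcover D (Finset.univ : Finset (Fin 3)) T (fun _ => ∅)
    (fun k _ => hT k) side TN W fun X hX hTN => by
      obtain ⟨k, hk⟩ := hcover X hX (by convert hTN using 3)
      exact ⟨k, Finset.mem_univ k, hk⟩
  rw [Finset.card_univ, Fintype.card_fin] at key₀
  have key : (D.powerset.filter fun X => TN X).card ≤ 3 * (D.powerset.filter fun Z => W Z).card := by
    convert key₀ using 5
  have e : ((D.powerset.filter fun X => TN X).card : ℝ) ≤ 3 * ((D.powerset.filter fun Z => W Z).card : ℝ) := by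
    exact_mod_cast key
  exact e

end ThreeClusterSwap

end Summit.CriticalPhenomena.PercolationContinuityZ3.Theorems
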